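import Literature.Geometry.Lorentzian.CoordPinchingMinimum
import HarnessLib

/-!
# First and second order conditions at a cut-off affine pinching MAXIMUM, along geodesics

The calculus step of the localised maximum principle for a pinching quantity of the Ricci tensor
(Hamilton's device of geodesics carrying a parallel vector, as in `CoordPinchingMinimum.lean`,
Eminenti–La Nave–Mantegazza 2008, §3; here for a MAXIMUM, with a cut-off factor and an affine
comparison form). In the coordinate language (`MetricCoord`, metric components `G` on an open `V`):
a smooth form field `β`, smooth functions `S`, `f` on `V`, a one-variable `C²` function `Θ`
(the cut-off profile, composed with `f`), constants `c₀ α κ u₀` and a vector `v` with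

  `Θ(f y) · (c₀ G_y(w,w) + 2α β_y(w,w) + κ S(y) G_y(w,w)) ≤ u₀ G_y(w,w)`  for all `y ∈ V`, `w`,

and EQUALITY at `(x, v)`. Along the geodesic through `x` in direction `X` carrying the parallel
transport `W` of `v` the function `σ ↦ Θ(f) (c₀ G(W,W) + 2α β(W,W) + κ S G(W,W)) − u₀ G(W,W)` is
`≤ 0` and vanishes at `σ = 0`, so its first derivative vanishes and its second derivative is `≤ 0`
there (`G(W,W)` is constant, `d/dσ β(W,W) = (∇_u β)(W,W)`, `d²/dσ² = (∇²_{u,u}β)(W,W)`,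
`d/dσ S = dS(u)`, `d²/dσ² S = Hess S(u,u)`):

* **`IsMetricOn.cutoff_affine_maximum`** — for every direction `X`, with
  `L₀ = c₀ G(v,v) + 2α β(v,v) + κ S G(v,v)` and `ℓ'(X) = 2α (∇_X β)(v,v) + κ dS(X) G(v,v)`:
  `Θ'(f) df(X) L₀ + Θ(f) ℓ'(X) = 0` and
  `(Θ''(f) df(X)² + Θ'(f) Hess f(X,X)) L₀ + 2 Θ'(f) df(X) ℓ'(X)
     + Θ(f) (2α (∇²_{X,X}β)(v,v) + κ Hess S(X,X) G(v,v)) ≤ 0`;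
* **`IsMetricOn.cutoff_affine_maximum_laplacian`** — summed over a `G_x`-orthonormal basis:
  the same with `|∇f|²_G`, `Δf`, `Δ S` and the rough Laplacian `(Δβ)(v,v)`, plus the list of
  first-order identities.

This is the second-order information used by the elliptic proof that three-dimensional gradient
shrinking solitons have `sect ≥ 0`. Everything is proved; no definitions are introduced.

## References

* M. Eminenti, G. La Nave, C. Mantegazza, *Ricci solitons: the equation point of view*,
  manuscripta math. 127 (2008), §3 (p. 7). [EminentiLanaveMantegazza2008]
* R. S. Hamilton, *Four-manifolds with positive curvature operator*, J. Differential Geom. 24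
  (1986), §4, proof of Lemma 4.2. [Hamilton1986]
* B. O'Neill, *Semi-Riemannian geometry*, 1983, Ch. 3, Def. 3.18, Prop. 3.37. [ONeill1983]
-/

noncomputable section

set_option maxSynthPendingDepth 3

open Set Filter Metric Module
open scoped Topology ContDiff

namespace Literature.Geometry.Lorentzian

namespace MetricCoord

variable {E : Type*} [NormedAddCommGroup E] [NormedSpace ℝ E] [FiniteDimensional ℝ E]
  [CompleteSpace E] {G : E → E →L[ℝ] E →L[ℝ] ℝ} {V : Set E}

/-! ### One-variable calculus: the second-order condition for `(Θ ∘ a) · ℓ` at a maximum -/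

section OneVariable

/-- **Second derivative of a product `P · L`**: if `P' , L'` are derivatives of `P, L` near `0`
and `P'', L''` their derivatives at `0`, then `σ ↦ P' σ L σ + P σ L' σ` has derivative
`P'' L + 2 P' L' + P L''` at `0`. [folklore] -/
theorem hasDerivAt_mul_deriv {P P' L L' : ℝ → ℝ} {P'' L'' : ℝ}
    (hP : HasDerivAt P (P' 0) 0) (hL : HasDerivAt L (L' 0) 0)
    (hP' : HasDerivAt P' P'' 0) (hL' : HasDerivAt L' L'' 0) :
    HasDerivAt (fun σ ↦ P' σ * L σ + P σ * L' σ)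
      (P'' * L 0 + 2 * (P' 0 * L' 0) + P 0 * L'') 0 := by
  have h := (hP'.mul hL).add (hP.mul hL')
  refine h.congr_deriv ?_
  ring

/-- **First and second order conditions at a local maximum, product form**: if
`H = P · L − c` has a local maximum at `0`, `H` is differentiable near `0` with
`H' = P' L + P L'`, and `P', L'` are differentiable at `0`, then `P'(0) L(0) + P(0) L'(0) = 0` and
`P''(0) L(0) + 2 P'(0) L'(0) + P(0) L''(0) ≤ 0`. [folklore] -/
theorem first_second_order_of_isLocalMax_mul {P P' L L' : ℝ → ℝ} {P'' L'' c : ℝ}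
    (hP : ∀ᶠ σ in 𝓝 0, HasDerivAt P (P' σ) σ) (hL : ∀ᶠ σ in 𝓝 0, HasDerivAt L (L' σ) σ)
    (hP' : HasDerivAt P' P'' 0) (hL' : HasDerivAt L' L'' 0)
    (hmax : IsLocalMax (fun σ ↦ P σ * L σ - c) 0) :
    P' 0 * L 0 + P 0 * L' 0 = 0 ∧ P'' * L 0 + 2 * (P' 0 * L' 0) + P 0 * L'' ≤ 0 := by
  set H : ℝ → ℝ := fun σ ↦ P σ * L σ - c with hH
  set H' : ℝ → ℝ := fun σ ↦ P' σ * L σ + P σ * L' σ with hH'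
  have hHd : ∀ᶠ σ in 𝓝 0, HasDerivAt H (H' σ) σ := by
    filter_upwards [hP, hL] with σ h1 h2
    exact ((h1.mul h2).sub_const c).congr_deriv (by simp [hH'])
  have hH0 : HasDerivAt H (H' 0) 0 := hHd.self_of_nhds
  have hfirst : H' 0 = 0 := hmax.hasDerivAt_eq_zero hH0
  refine ⟨by simpa [hH'] using hfirst, ?_⟩
  -- second order on `-H`, a local minimum
  have hmin : IsLocalMin (fun σ ↦ -H σ) 0 := hmax.neg
  have hcont : ContinuousAt (fun σ ↦ -H σ) 0 := hH0.continuousAt.neg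
  have h2 := Literature.Analysis.PDE.deriv_deriv_nonneg_of_isLocalMin hmin hcont
  have hH'' : HasDerivAt H' (P'' * L 0 + 2 * (P' 0 * L' 0) + P 0 * L'') 0 :=
    hasDerivAt_mul_deriv hP.self_of_nhds hL.self_of_nhds hP' hL'
  have hderivH : deriv (fun σ ↦ -H σ) =ᶠ[𝓝 0] fun σ ↦ -H' σ := by
    filter_upwards [hHd] with σ hσ using hσ.neg.deriv
  have hH''n : HasDerivAt (fun σ ↦ -H' σ) _ 0 := hH''.neg
  rw [hderivH.deriv_eq, hH''n.deriv] at h2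
  linarith

end OneVariable

/-! ### The cut-off affine maximum -/

section Maximum

variable {x : E}

omit [FiniteDimensional ℝ E] [CompleteSpace E] in
/-- Components of a solution of the geodesic/parallel system (one frame vector). [folklore] -/
private theorem hasDerivAt_components₁ {q : ℝ → E × E × (Fin 1 → E)} {σ : ℝ}
    (h : HasDerivAt q (geoField G (q σ)) σ) :
    HasDerivAt (fun τ ↦ (q τ).1) ((q σ).2.1) σ ∧
      HasDerivAt (fun τ ↦ (q τ).2.1) (-chrAt G (q σ).1 (q σ).2.1 (q σ).2.1) σ ∧
      ∀ j, HasDerivAt (fun τ ↦ (q τ).2.2 j) (-chrAt G (q σ).1 (q σ).2.1 ((q σ).2.2 j)) σ := by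
  refine ⟨?_, ?_, fun j ↦ ?_⟩
  · exact ((ContinuousLinearMap.fst ℝ E (E × (Fin 1 → E))).hasFDerivAt.comp_hasDerivAt σ h :)
  · exact (((ContinuousLinearMap.fst ℝ E (Fin 1 → E)).comp
      (ContinuousLinearMap.snd ℝ E (E × (Fin 1 → E)))).hasFDerivAt.comp_hasDerivAt σ h :)
  · exact (((ContinuousLinearMap.proj j : (Fin 1 → E) →L[ℝ] E).comp
      ((ContinuousLinearMap.snd ℝ E (Fin 1 → E)).comp
        (ContinuousLinearMap.snd ℝ E (E × (Fin 1 → E))))).hasFDerivAt.comp_hasDerivAt σ h :)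

/-- **First and second order conditions at a cut-off affine pinching maximum, in one direction**
(Hamilton's geodesic/parallel-transport device, as in `IsMetricOn.pinching_minimum`, for a maximum):
let `β` be a smooth form field, `S`, `f` smooth functions on `V`, `Θ` a `C²` function of one
variable and `c₀ α κ u₀` constants with
`Θ(f y)(c₀ G_y(w,w) + 2α β_y(w,w) + κ S(y) G_y(w,w)) ≤ u₀ G_y(w,w)` for all `y ∈ V`, `w`, and
equality at `(x, v)`. Then for every `X`, writing `L₀ = c₀ G(v,v) + 2α β(v,v) + κ S G(v,v)` and
`ℓ'(X) = 2α(∇_X β)(v,v) + κ dS(X) G(v,v)`: `Θ'(f) df(X) L₀ + Θ(f) ℓ'(X) = 0` and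
`(Θ''(f)df(X)² + Θ'(f) Hess f(X,X)) L₀ + 2Θ'(f)df(X) ℓ'(X) + Θ(f)(2α(∇²_{X,X}β)(v,v) + κ Hess S(X,X) G(v,v)) ≤ 0`.
[cite: EminentiLanaveMantegazza2008, §3 (p. 7)] [cite: Hamilton1986, §4, p. 162] -/
theorem IsMetricOn.cutoff_affine_maximum (hG : IsMetricOn G V) (hx : x ∈ V)
    {β : E → E →L[ℝ] E →L[ℝ] ℝ} (hβ : ContDiffOn ℝ ∞ β V) {S f : E → ℝ}
    (hS : ContDiffOn ℝ ∞ S V) (hf : ContDiffOn ℝ ∞ f V) {Θ Θ' Θ'' : ℝ → ℝ}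
    (hΘ : ∀ t, HasDerivAt Θ (Θ' t) t) (hΘ' : ∀ t, HasDerivAt Θ' (Θ'' t) t)
    {c₀ α κ u₀ : ℝ} {v : E}
    (hle : ∀ y ∈ V, ∀ w,
      Θ (f y) * (c₀ * G y w w + 2 * α * β y w w + κ * S y * G y w w) ≤ u₀ * G y w w)
    (heq : Θ (f x) * (c₀ * G x v v + 2 * α * β x v v + κ * S x * G x v v) = u₀ * G x v v)
    (X : E) :
    Θ' (f x) * fderiv ℝ f x X * (c₀ * G x v v + 2 * α * β x v v + κ * S x * G x v v)
        + Θ (f x) * (2 * α * cov₂At G β x X v v + κ * fderiv ℝ S x X * G x v v) = 0 ∧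
      (Θ'' (f x) * (fderiv ℝ f x X) ^ 2 + Θ' (f x) * hessAt G f x X X)
            * (c₀ * G x v v + 2 * α * β x v v + κ * S x * G x v v)
          + 2 * ((Θ' (f x) * fderiv ℝ f x X)
            * (2 * α * cov₂At G β x X v v + κ * fderiv ℝ S x X * G x v v))
          + Θ (f x) * (2 * α * cov₃At G (cov₂At G β) x X X v v
            + κ * hessAt G S x X X * G x v v) ≤ 0 := by
  -- the geodesic in direction `X` with the parallel transport of `v`
  set R : ℝ := max ‖X‖ ‖(fun _ : Fin 1 ↦ v)‖ with hR
  obtain ⟨ε, hε, Lb, -, D, -, hDV, hsol⟩ :=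
    hG.exists_geodesicFrames (ι := Fin 1) (K := {x}) isCompact_singleton
      (singleton_subset_iff.2 hx) R
  obtain ⟨q, hq0, hqd, hqD, -⟩ :=
    hsol (x, X, fun _ ↦ v) rfl (le_max_left _ _) (le_max_right _ _)
  have hIoo : ∀ σ ∈ Ioo (-ε) ε, Icc (-ε) ε ∈ 𝓝 σ := fun σ hσ ↦ Icc_mem_nhds hσ.1 hσ.2
  have hder : ∀ σ ∈ Ioo (-ε) ε, HasDerivAt q (geoField G (q σ)) σ := fun σ hσ ↦
    (hqd σ (Ioo_subset_Icc_self hσ)).hasDerivAt (hIoo σ hσ)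
  have hV : ∀ σ ∈ Ioo (-ε) ε, (q σ).1 ∈ V := fun σ hσ ↦ hDV (hqD σ (Ioo_subset_Icc_self hσ))
  have h0 : (0 : ℝ) ∈ Ioo (-ε) ε := ⟨by linarith, hε⟩
  have hnhds : Ioo (-ε) ε ∈ 𝓝 (0 : ℝ) := Ioo_mem_nhds h0.1 h0.2
  have hq01 : (q 0).1 = x := by rw [hq0]
  have hq02 : (q 0).2.1 = X := by rw [hq0]
  have hq03 : (q 0).2.2 0 = v := by rw [hq0]
  -- smoothness along the curve
  have hβd : ∀ σ ∈ Ioo (-ε) ε, ContDiffAt ℝ ∞ β (q σ).1 := fun σ hσ ↦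
    hβ.contDiffAt (hG.mem_nhds (hV σ hσ))
  have hSd : ∀ σ ∈ Ioo (-ε) ε, ContDiffAt ℝ ∞ S (q σ).1 := fun σ hσ ↦
    hS.contDiffAt (hG.mem_nhds (hV σ hσ))
  have hfd : ∀ σ ∈ Ioo (-ε) ε, ContDiffAt ℝ ∞ f (q σ).1 := fun σ hσ ↦
    hf.contDiffAt (hG.mem_nhds (hV σ hσ))
  -- the pieces along the curve: `gW = G(W,W)`, `bW = β(W,W)`, `Sγ = S ∘ γ`, `fγ = f ∘ γ`
  set gW : ℝ → ℝ := fun σ ↦ G (q σ).1 ((q σ).2.2 0) ((q σ).2.2 0) with hgW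
  set bW : ℝ → ℝ := fun σ ↦ β (q σ).1 ((q σ).2.2 0) ((q σ).2.2 0) with hbW
  set bW' : ℝ → ℝ := fun σ ↦ cov₂At G β (q σ).1 (q σ).2.1 ((q σ).2.2 0) ((q σ).2.2 0) with hbW'
  set bW'' : ℝ → ℝ := fun σ ↦
    cov₃At G (cov₂At G β) (q σ).1 (q σ).2.1 (q σ).2.1 ((q σ).2.2 0) ((q σ).2.2 0) with hbW''
  set Sγ : ℝ → ℝ := fun σ ↦ S (q σ).1 with hSγ
  set Sγ' : ℝ → ℝ := fun σ ↦ fderiv ℝ S (q σ).1 (q σ).2.1 with hSγ'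
  set Sγ'' : ℝ → ℝ := fun σ ↦ hessAt G S (q σ).1 (q σ).2.1 (q σ).2.1 with hSγ''
  set fγ : ℝ → ℝ := fun σ ↦ f (q σ).1 with hfγ
  set fγ' : ℝ → ℝ := fun σ ↦ fderiv ℝ f (q σ).1 (q σ).2.1 with hfγ'
  set fγ'' : ℝ → ℝ := fun σ ↦ hessAt G f (q σ).1 (q σ).2.1 (q σ).2.1 with hfγ''
  have hgWd : ∀ σ ∈ Ioo (-ε) ε, HasDerivAt gW 0 σ := by
    intro σ hσ
    obtain ⟨h1, -, h3⟩ := hasDerivAt_components₁ (hder σ hσ)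
    exact hG.hasDerivAt_pairing_parallel (γ := fun τ ↦ (q τ).1) (u := fun τ ↦ (q τ).2.1)
      (W := fun τ ↦ (q τ).2.2) (hV σ hσ) h1 h3 0 0
  have hbWd : ∀ σ ∈ Ioo (-ε) ε, HasDerivAt bW (bW' σ) σ := by
    intro σ hσ
    obtain ⟨h1, -, h3⟩ := hasDerivAt_components₁ (hder σ hσ)
    exact IsMetricOn.hasDerivAt_bilin_parallel (G := G) (γ := fun τ ↦ (q τ).1)
      (u := fun τ ↦ (q τ).2.1) (W := fun τ ↦ (q τ).2.2) h1 h3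
      ((hβd σ hσ).differentiableAt (by simp)) 0 0
  have hbW'd : ∀ σ ∈ Ioo (-ε) ε, HasDerivAt bW' (bW'' σ) σ := by
    intro σ hσ
    obtain ⟨h1, h2, h3⟩ := hasDerivAt_components₁ (hder σ hσ)
    exact hG.hasDerivAt_cov₂At_parallel (γ := fun τ ↦ (q τ).1) (u := fun τ ↦ (q τ).2.1)
      (W := fun τ ↦ (q τ).2.2) (hV σ hσ) h1 h2 h3 (hβd σ hσ) 0 0
  have hSγd : ∀ σ ∈ Ioo (-ε) ε, HasDerivAt Sγ (Sγ' σ) σ := by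
    intro σ hσ
    obtain ⟨h1, -, -⟩ := hasDerivAt_components₁ (hder σ hσ)
    exact hasDerivAt_comp_curve (γ := fun τ ↦ (q τ).1) (u := fun τ ↦ (q τ).2.1)
      ((hSd σ hσ).differentiableAt (by simp)) h1
  have hSγ'd : ∀ σ ∈ Ioo (-ε) ε, HasDerivAt Sγ' (Sγ'' σ) σ := by
    intro σ hσ
    obtain ⟨h1, h2, -⟩ := hasDerivAt_components₁ (hder σ hσ)
    have hD : DifferentiableAt ℝ (fderiv ℝ S) (q σ).1 :=
      ((hSd σ hσ).fderiv_right (m := ∞) (by simp)).differentiableAt (by simp)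
    exact hasDerivAt_fderiv_geodesic (G := G) (γ := fun τ ↦ (q τ).1)
      (u := fun τ ↦ (q τ).2.1) hD h1 h2
  have hfγd : ∀ σ ∈ Ioo (-ε) ε, HasDerivAt fγ (fγ' σ) σ := by
    intro σ hσ
    obtain ⟨h1, -, -⟩ := hasDerivAt_components₁ (hder σ hσ)
    exact hasDerivAt_comp_curve (γ := fun τ ↦ (q τ).1) (u := fun τ ↦ (q τ).2.1)
      ((hfd σ hσ).differentiableAt (by simp)) h1
  have hfγ'd : ∀ σ ∈ Ioo (-ε) ε, HasDerivAt fγ' (fγ'' σ) σ := by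
    intro σ hσ
    obtain ⟨h1, h2, -⟩ := hasDerivAt_components₁ (hder σ hσ)
    have hD : DifferentiableAt ℝ (fderiv ℝ f) (q σ).1 :=
      ((hfd σ hσ).fderiv_right (m := ∞) (by simp)).differentiableAt (by simp)
    exact hasDerivAt_fderiv_geodesic (G := G) (γ := fun τ ↦ (q τ).1)
      (u := fun τ ↦ (q τ).2.1) hD h1 h2
  -- the two factors `P = Θ ∘ fγ` and `L = c₀ gW + 2α bW + κ Sγ gW`, and their derivatives
  set P : ℝ → ℝ := fun σ ↦ Θ (fγ σ) with hP
  set P' : ℝ → ℝ := fun σ ↦ Θ' (fγ σ) * fγ' σ with hP'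
  set L : ℝ → ℝ := fun σ ↦ c₀ * gW σ + 2 * α * bW σ + κ * Sγ σ * gW σ with hL
  set L' : ℝ → ℝ := fun σ ↦ 2 * α * bW' σ + κ * Sγ' σ * gW σ with hL'
  have hPd : ∀ σ ∈ Ioo (-ε) ε, HasDerivAt P (P' σ) σ := by
    intro σ hσ
    exact ((hΘ (fγ σ)).comp σ (hfγd σ hσ)).congr_deriv (by simp [hP'])
  have hLd : ∀ σ ∈ Ioo (-ε) ε, HasDerivAt L (L' σ) σ := by
    intro σ hσ
    have h := (((hgWd σ hσ).const_mul c₀).add ((hbWd σ hσ).const_mul (2 * α))).add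
      (((hSγd σ hσ).const_mul κ).mul (hgWd σ hσ))
    refine h.congr_deriv ?_
    simp only [hL', mul_zero, add_zero, zero_add]
  have hP'0 : HasDerivAt P' (Θ'' (fγ 0) * fγ' 0 ^ 2 + Θ' (fγ 0) * fγ'' 0) 0 := by
    have h := ((hΘ' (fγ 0)).comp 0 (hfγd 0 h0)).mul (hfγ'd 0 h0)
    refine h.congr_deriv ?_
    simp only [Function.comp_apply]
    ring
  have hL'0 : HasDerivAt L' (2 * α * bW'' 0 + κ * Sγ'' 0 * gW 0) 0 := by
    have h := ((hbW'd 0 h0).const_mul (2 * α)).add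
      (((hSγ'd 0 h0).const_mul κ).mul (hgWd 0 h0))
    refine h.congr_deriv ?_
    simp only [mul_zero, add_zero]
  -- the local maximum of `P L − u₀ gW`; since `gW` is constant near `0` we may freeze it
  have hgWconst : ∀ᶠ σ in 𝓝 0, gW σ = gW 0 := by
    -- `gW` has zero derivative on the interval, hence is constant there
    have hcont : ∀ σ ∈ Ioo (-ε) ε, HasDerivWithinAt gW 0 (Ioo (-ε) ε) σ := fun σ hσ ↦
      (hgWd σ hσ).hasDerivWithinAt
    filter_upwards [hnhds] with σ hσ
    exact (convex_Ioo (-ε) ε).is_const_of_fderivWithin_eq_zero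
      (fun τ hτ ↦ (hgWd τ hτ).differentiableAt.differentiableWithinAt)
      (fun τ hτ ↦ by
        rw [fderivWithin_eq_fderiv (isOpen_Ioo.uniqueDiffWithinAt hτ)
          (hgWd τ hτ).differentiableAt, (hgWd τ hτ).hasFDerivAt.fderiv]
        ext; simp) hσ h0
  have hmax : IsLocalMax (fun σ ↦ P σ * L σ - u₀ * gW 0) 0 := by
    filter_upwards [hnhds, hgWconst] with σ hσ hσg
    have h := hle _ (hV σ hσ) ((q σ).2.2 0)
    have hx0 : P 0 * L 0 - u₀ * gW 0 = 0 := by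
      simp only [hP, hL, hfγ, hgW, hbW, hSγ, hq01, hq03, heq]
      ring
    rw [hx0]
    have : P σ * L σ = Θ (f (q σ).1) * (c₀ * G (q σ).1 ((q σ).2.2 0) ((q σ).2.2 0)
        + 2 * α * β (q σ).1 ((q σ).2.2 0) ((q σ).2.2 0)
        + κ * S (q σ).1 * G (q σ).1 ((q σ).2.2 0) ((q σ).2.2 0)) := by
      simp only [hP, hL, hfγ, hgW, hbW, hSγ]
    rw [this, ← hσg]
    linarith
  have hPev : ∀ᶠ σ in 𝓝 0, HasDerivAt P (P' σ) σ := by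
    filter_upwards [hnhds] with σ hσ using hPd σ hσ
  have hLev : ∀ᶠ σ in 𝓝 0, HasDerivAt L (L' σ) σ := by
    filter_upwards [hnhds] with σ hσ using hLd σ hσ
  obtain ⟨hfirst, hsecond⟩ := first_second_order_of_isLocalMax_mul hPev hLev hP'0 hL'0 hmax
  -- read off at `σ = 0`
  have hgW0 : gW 0 = G x v v := by simp only [hgW, hq01, hq03]
  constructor
  · have h := hfirst
    simp only [hP, hP', hL, hL', hfγ, hfγ', hgW, hbW, hbW', hSγ, hSγ', hq01, hq02, hq03] at h
    linarith
  · have h := hsecond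
    simp only [hP, hP', hL, hL', hfγ, hfγ', hfγ'', hgW, hbW, hbW', hbW'', hSγ, hSγ', hSγ'',
      hq01, hq02, hq03] at h
    nlinarith [h]

end Maximum

/-! ### The traced conditions -/

section Traced

variable {x : E}

omit [FiniteDimensional ℝ E] [CompleteSpace E] in
/-- `♯α = Σ_k α(e_k) e_k` in a `G_x`-orthonormal basis. [cite: ONeill1983, Ch. 2, Lemma 2.25] -/
theorem sharpAt_eq_sum_of_orthonormal' {ι : Type*} [Fintype ι] [DecidableEq ι] (e : Basis ι ℝ E)
    (he : ∀ i j, G x (e i) (e j) = if i = j then 1 else 0) (hi : (G x).IsInvertible)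
    (hs : ∀ v w, G x v w = G x w v) (φ : E →L[ℝ] ℝ) :
    sharpAt G x φ = ∑ k, φ (e k) • e k := by
  refine sharpAt_eq_of_forall hi fun w ↦ ?_
  conv_rhs => rw [← sum_apply_smul_of_orthonormal e he w]
  rw [map_sum, map_sum, _root_.sum_apply]
  refine Finset.sum_congr rfl fun k _ ↦ ?_
  rw [map_smul, map_smul, _root_.smul_apply, smul_eq_mul, smul_eq_mul, hs (e k) w, mul_comm]

/-- **The traced first and second order conditions at a cut-off affine pinching maximum**:
under the hypotheses of `cutoff_affine_maximum` and with `G_x` positive definite, writing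
`♯df = sharpAt G x (df_x)`, `L₀ = c₀ G(v,v) + 2α β(v,v) + κ S G(v,v)`:
the first-order identities in every direction, and
`(Θ''(f) df(♯df) + Θ'(f) Δf) L₀ + 2Θ'(f)(2α (∇_{♯df}β)(v,v) + κ dS(♯df) G(v,v))
   + Θ(f)(2α (Δβ)(v,v) + κ (ΔS) G(v,v)) ≤ 0`
(sum of the one-direction inequalities over a `G_x`-orthonormal basis; `Δ` the coordinate
Laplacian `lapAt`, `Δβ` the rough Laplacian `lapBilinAt`).
[cite: EminentiLanaveMantegazza2008, §3 (p. 7)] [cite: Hamilton1986, §4, p. 162] -/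
theorem IsMetricOn.cutoff_affine_maximum_laplacian (hG : IsMetricOn G V) (hx : x ∈ V)
    (hpos : ∀ w : E, w ≠ 0 → 0 < G x w w)
    {β : E → E →L[ℝ] E →L[ℝ] ℝ} (hβ : ContDiffOn ℝ ∞ β V) {S f : E → ℝ}
    (hS : ContDiffOn ℝ ∞ S V) (hf : ContDiffOn ℝ ∞ f V) {Θ Θ' Θ'' : ℝ → ℝ}
    (hΘ : ∀ t, HasDerivAt Θ (Θ' t) t) (hΘ' : ∀ t, HasDerivAt Θ' (Θ'' t) t)
    {c₀ α κ u₀ : ℝ} {v : E}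
    (hle : ∀ y ∈ V, ∀ w,
      Θ (f y) * (c₀ * G y w w + 2 * α * β y w w + κ * S y * G y w w) ≤ u₀ * G y w w)
    (heq : Θ (f x) * (c₀ * G x v v + 2 * α * β x v v + κ * S x * G x v v) = u₀ * G x v v) :
    (∀ X, Θ' (f x) * fderiv ℝ f x X * (c₀ * G x v v + 2 * α * β x v v + κ * S x * G x v v)
        + Θ (f x) * (2 * α * cov₂At G β x X v v + κ * fderiv ℝ S x X * G x v v) = 0) ∧
      (Θ'' (f x) * fderiv ℝ f x (sharpAt G x (fderiv ℝ f x)) + Θ' (f x) * lapAt G f x)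
            * (c₀ * G x v v + 2 * α * β x v v + κ * S x * G x v v)
          + 2 * (Θ' (f x)
            * (2 * α * cov₂At G β x (sharpAt G x (fderiv ℝ f x)) v v
              + κ * fderiv ℝ S x (sharpAt G x (fderiv ℝ f x)) * G x v v))
          + Θ (f x) * (2 * α * lapBilinAt G β x v v + κ * lapAt G S x * G x v v) ≤ 0 := by
  have hi := hG.isInvertible x hx
  have hs := hG.symm x hx
  refine ⟨fun X ↦ (hG.cutoff_affine_maximum hx hβ hS hf hΘ hΘ' hle heq X).1, ?_⟩
  classical
  obtain ⟨e, he⟩ := exists_orthonormal_basis hs hpos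
  -- the sums over the frame
  have hsharp := sharpAt_eq_sum_of_orthonormal' e he hi hs (fderiv ℝ f x)
  have hgrad : fderiv ℝ f x (sharpAt G x (fderiv ℝ f x)) = ∑ k, fderiv ℝ f x (e k) ^ 2 := by
    rw [hsharp, map_sum]
    refine Finset.sum_congr rfl fun k _ ↦ ?_
    rw [map_smul, smul_eq_mul, sq]
  have hcov : cov₂At G β x (sharpAt G x (fderiv ℝ f x)) v v =
      ∑ k, fderiv ℝ f x (e k) * cov₂At G β x (e k) v v := by
    rw [hsharp, map_sum]
    simp only [FunLike.coe_sum, Finset.sum_apply, map_smul, FunLike.coe_smul, Pi.smul_apply,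
      smul_eq_mul]
  have hdS : fderiv ℝ S x (sharpAt G x (fderiv ℝ f x)) =
      ∑ k, fderiv ℝ f x (e k) * fderiv ℝ S x (e k) := by
    rw [hsharp, map_sum]
    refine Finset.sum_congr rfl fun k _ ↦ ?_
    rw [map_smul, smul_eq_mul]
  have hlapf : lapAt G f x = ∑ k, hessAt G f x (e k) (e k) := by
    rw [lapAt_eq_sum G e f x]
    refine Finset.sum_congr rfl fun k _ ↦ ?_
    simp only [← hessAt_apply, sum_ginv_mul_of_orthonormal e he hi]
  have hlapS : lapAt G S x = ∑ k, hessAt G S x (e k) (e k) := by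
    rw [lapAt_eq_sum G e S x]
    refine Finset.sum_congr rfl fun k _ ↦ ?_
    simp only [← hessAt_apply, sum_ginv_mul_of_orthonormal e he hi]
  have hlapβ : lapBilinAt G β x v v = ∑ k, cov₃At G (cov₂At G β) x (e k) (e k) v v := by
    rw [lapBilinAt_apply_eq_sum G β e x v v]
    refine Finset.sum_congr rfl fun k _ ↦ ?_
    rw [sum_ginv_mul_of_orthonormal e he hi (fun l ↦ cov₃At G (cov₂At G β) x (e k) (e l) v v) k]
  -- sum the one-direction inequalities
  have hsum := Finset.sum_nonpos fun k (_ : k ∈ Finset.univ) ↦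
    (hG.cutoff_affine_maximum hx hβ hS hf hΘ hΘ' hle heq (e k)).2
  rw [hgrad, hcov, hdS, hlapf, hlapS, hlapβ]
  have hexp : (Θ'' (f x) * ∑ k, fderiv ℝ f x (e k) ^ 2 + Θ' (f x) * ∑ k, hessAt G f x (e k) (e k))
            * (c₀ * G x v v + 2 * α * β x v v + κ * S x * G x v v)
          + 2 * (Θ' (f x)
            * (2 * α * ∑ k, fderiv ℝ f x (e k) * cov₂At G β x (e k) v v
              + κ * (∑ k, fderiv ℝ f x (e k) * fderiv ℝ S x (e k)) * G x v v))
          + Θ (f x) * (2 * α * ∑ k, cov₃At G (cov₂At G β) x (e k) (e k) v v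
            + κ * (∑ k, hessAt G S x (e k) (e k)) * G x v v) =
      ∑ k, ((Θ'' (f x) * (fderiv ℝ f x (e k)) ^ 2 + Θ' (f x) * hessAt G f x (e k) (e k))
            * (c₀ * G x v v + 2 * α * β x v v + κ * S x * G x v v)
          + 2 * ((Θ' (f x) * fderiv ℝ f x (e k))
            * (2 * α * cov₂At G β x (e k) v v + κ * fderiv ℝ S x (e k) * G x v v))
          + Θ (f x) * (2 * α * cov₃At G (cov₂At G β) x (e k) (e k) v v
            + κ * hessAt G S x (e k) (e k) * G x v v)) := by
    simp only [Finset.mul_sum, Finset.sum_mul, ← Finset.sum_add_distrib]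
    refine Finset.sum_congr rfl fun k _ ↦ ?_
    ring
  rw [hexp]
  exact hsum

end Traced

end MetricCoord

end Literature.Geometry.Lorentzian

end
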